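import Summits.ABC.IUTFork.Thm311RealDegreeArch
import HarnessLib

/-!
# [IUTchIII] Theorem 3.11 over real definitions, R7: the number-field copies `(M^⊛_mod)_j` of (i) (c) INSTANTIATED

Record-only file (D-0012) of the abc-iut cell (seat abc-iut-c312-1); TAKES NO SIDE. B (`Thm311Multirad`) types the data
(c) of [IUTchIII] Thm. 3.11 (i) — kurims p. 154: "for each `j ∈ 𝔽_l^⋇`, … a copy (labeled by `n, ∘` and `j`) of the number field
`(^{n,∘}M^⊛_MOD)_j = (^{n,∘}M^⊛_mod)_j ⊆ 𝓘^ℚ(^{S^±_{j+1}}F_{V_ℚ}) := ∏_{v_ℚ ∈ V_ℚ} 𝓘^ℚ(^{S^±_{j+1}}F_{v_ℚ})`" — as the BINDER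
`MRData.Mmod : ∀ j : LabelStar, Set (L.GlobalPacket j.1)`, and every real instantiation of the cell so far (c312-5
`Situation.ofShells`, this seat's R2/R4/R5 `full_statement_*`) leaves it a free argument `Mmod₀`. This file gives it its
real referent in the Dupuy–Hilado-level model of the cell (`Thm311Real`: "`F` plays `F_mod`"): the copy of the number field
`F` inside the global tensor packet `∏_{v_ℚ} ⊗_{i ∈ S^±_{j+1}} (⊕_{v | v_ℚ} K_v)` at the factor labelled `j` —
`Real.mmodElt j a := (1 ⊗ ⋯ ⊗ 1 ⊗ (ι_v(a))_{v | v_ℚ})_{v_ℚ}` with the diagonal image of `a ∈ F` in the factor `selfIndex j` and the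
unit `1 = (1)_v` of the ring `⊕_{v | v_ℚ} K_v` in the other factors (the convention of R's `Real.idealBox` and of abc-iut-w4-d001's
`Real.archPrincipalElt`: the number field acts on the `j`-labelled factor), `Real.Mmod j := range (mmodElt j)`. Then the
premise-of-record theorem with (c)'s number fields no longer a binder: `Real.full_statement_honest_mmod` (R5's
`full_statement_honest` at `Mmod₀ := Real.Mmod`). Census bookkeeping only: the typed Theorem 3.11 constrains `Mmod` through the
class `^{n,∘}R^{LGP}` alone, so nothing new is proved about [IUTchIII]. [claim: Mochizuki2012, status: disputed]
[cite: DupuyHilado2025, §3.7]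
-/

noncomputable section

open Set Function NumberField IsDedekindDomain

namespace Summit.ABC.IUTFork.Thm311.Real

open Cor312Vol CategoryTheory Literature.IUT.LogThetaLattice Literature.IUT.LogVolume

variable {F : Type} [Field F] [NumberField F] (X : PilotData F) (logv : PadicLogs F)

/-- **`ι_j(a)`** — the element of the global tensor packet `∏_{v_ℚ} 𝓘^ℚ(^{S^±_{j+1}}F_{v_ℚ})` with the diagonal image
`(ι_v(a))_{v | v_ℚ}` of `a ∈ F` (`F` playing `F_mod`) in the factor labelled `j` (`selfIndex j`) and the unit of `⊕_{v | v_ℚ} K_v`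
in the other factors ([IUTchIII] Thm. 3.11 (i) (c), p. 154: the copy `(M^⊛_mod)_j` "labeled by … `j`").
[claim: Mochizuki2012, status: disputed] -/
def mmodElt (j : (thetaIndex X).Label) (a : F) : (logShellsDH X logv).GlobalPacket j := fun vQ =>
  (logShellsDH X logv).tprod j vQ
    (Function.update (fun _ => fun v : (thetaIndex X).Fibre vQ => (1 : Carrier v.1)) ((thetaIndex X).selfIndex j)
      fun v : (thetaIndex X).Fibre vQ => algebraMap F (Carrier v.1) a)

/-- **`(^{n,∘}M^⊛_mod)_j` INSTANTIATED**: the copy of the number field `F` (playing `F_mod`) inside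
`∏_{v_ℚ} 𝓘^ℚ(^{S^±_{j+1}}F_{v_ℚ})` at the label `j ∈ 𝔽_l^⋇` — the real referent of B's binder `MRData.Mmod j`.
[claim: Mochizuki2012, status: disputed] -/
def Mmod (j : (thetaIndex X).LabelStar) : Set ((logShellsDH X logv).GlobalPacket j.1) := Set.range (mmodElt X logv j.1)

/-- Every `ι_j(a)` lies in the copy `(M^⊛_mod)_j`. [folklore] -/
theorem mmodElt_mem_Mmod (j : (thetaIndex X).LabelStar) (a : F) : mmodElt X logv j.1 a ∈ Mmod X logv j := ⟨a, rfl⟩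

/-- The copy `(M^⊛_mod)_j` is inhabited (it contains `ι_j(0)` and `ι_j(1)`). [folklore] -/
theorem Mmod_nonempty (j : (thetaIndex X).LabelStar) : (Mmod X logv j).Nonempty := ⟨_, mmodElt_mem_Mmod X logv j 1⟩

/-- `ι_j(1)` is the unit pure tensor `1 ⊗ ⋯ ⊗ 1` (all factors the unit of `⊕_{v | v_ℚ} K_v`). [folklore] -/
theorem mmodElt_one (j : (thetaIndex X).Label) :
    mmodElt X logv j 1 = fun vQ => (logShellsDH X logv).tprod j vQ fun _ v => (1 : Carrier v.1) := by
  funext vQ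
  simp only [mmodElt, map_one]
  congr 1
  exact Function.update_eq_self _ _

/-! ## The premise of record with (c)'s number fields instantiated -/

section Full

variable [Fintype (ArchFibre X)] (hc : ∀ w : InfinitePlace F, w.IsComplex)
  (archSub₀ : ∀ (j : (thetaIndex X).Label) (v : (thetaIndex X).V),
    Set ((logShellsDH X (analyticLogv F)).Packet j ((thetaIndex X).over v)))
  (act₀ : ∀ v : (thetaIndex X).V, v ∈ (thetaIndex X).Vbad →
    (logShellsDH X (analyticLogv F)).StarPacket v → Module.End ℚ ((logShellsDH X (analyticLogv F)).StarPacket v))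
  (region₀ : ℤ → ∀ j : (thetaIndex X).LabelStar, FinDivisor F → ∀ vQ : (thetaIndex X).VQ,
    Set ((logShellsDH X (analyticLogv F)).Packet j.1 vQ))
  (thetaDiv₀ : ℤ → ℤ → LgpDivisor F (thetaIndex X).lstar)
  {S : StripFrame.{0}} (G : LatticeGlue S) (Λ : LogThetaLatticeDiagram G.logData G.linkData)
  {Kap : Type} [Category.{0} Kap] (FM : Core S.DHT ⥤ Kap)
  (qroot : ∀ v : HeightOneSpectrum (𝓞 F), Carrier (.inr v : Place F))
  (ζ : ∀ v : HeightOneSpectrum (𝓞 F), (thetaIndex X).LabelStar → (Carrier (.inr v : Place F))ˣ)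

/-- **R5's `full_statement_honest` with (c)'s number fields INSTANTIATED** (`Mmod₀ := Real.Mmod`): the typed Theorem 3.11 holds
outright at the honest real instantiation whose data (c) are the genuine copies `(M^⊛_mod)_j` of `F` — one binder fewer in the
premise of record (remaining coric binders: `archSub₀`, `act₀`, `region₀`, `thetaDiv₀`, `qroot`, `ζ`). A measurement of the
typing; no side taken. [claim: Mochizuki2012, status: disputed] -/
theorem full_statement_honest_mmod :
    Summit.ABC.IUTFork.Thm311.FullSituation.Statement
      ({ LatticeSituation.ofShells (logShellsDH X (analyticLogv F)) F
            (archPkPrint X (analyticLogv F) stripAutDH (ismDH (analyticLogv F)) refl_mem_stripAutDH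
              (refl_mem_ismDH (analyticLogv F)))
            archSub₀
            (summandPiecesPrWith X (archPresentationDH X (analyticLogv F) hc).toLocalPieces
              (logvAnalytic_analyticLogv (F := F))).Adm
            (summandPiecesPrWith X (archPresentationDH X (analyticLogv F) hc).toLocalPieces
              (logvAnalytic_analyticLogv (F := F))).logvol
            (fun _ x _ => match x with
              | .inr v => splittingMonoidLGP X (analyticLogv F) stripAutDH (ismDH (analyticLogv F))
                  refl_mem_stripAutDH (refl_mem_ismDH (analyticLogv F)) v (qroot v) (ζ v)
              | .inl _ => ∅)
            (fun _ => act₀) (fun _ => Mmod X (analyticLogv F)) region₀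
            (fun _ _ => (summandPiecesPrWith X (archPresentationDH X (analyticLogv F) hc).toLocalPieces
              (logvAnalytic_analyticLogv (F := F))).Adm)
            (fun _ _ => (summandPiecesPrWith X (archPresentationDH X (analyticLogv F) hc).toLocalPieces
              (logvAnalytic_analyticLogv (F := F))).logvol)
            (fun _ _ x _ => match x with
              | .inr v => splittingMonoidLGP X (analyticLogv F) stripAutDH (ismDH (analyticLogv F))
                  refl_mem_stripAutDH (refl_mem_ismDH (analyticLogv F)) v (qroot v) (ζ v)
              | .inl _ => ∅)
            (fun _ _ => Mmod X (analyticLogv F))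
            (fun _ _ m' j vQ =>
              (logShellsDH X (analyticLogv F)).tprodSingleImages j vQ fun v => iterImage (analyticLogv F) m' v.1)
            (fun _ _ j vQ =>
              (logShellsDH X (analyticLogv F)).tprodSingleImages j vQ fun v => shell (analyticLogv F) v.1)
            thetaDiv₀ with
          G := fun _ j => GlobalDegrees.ofIdeals (logShellsDH X (analyticLogv F)) F j
            (idealRegionWith X (archUnitRegion X hc) (logvAnalytic_analyticLogv (F := F)) j.1)
          link := LinkData.ofGlueRadial G Λ FM } : FullSituation (thetaIndex X)) :=
  full_statement_honest X hc archSub₀ act₀ (Mmod X (analyticLogv F)) region₀ thetaDiv₀ G Λ FM qroot ζ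

end Full

end Summit.ABC.IUTFork.Thm311.Real

end
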